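import Summits.BirchSwinnertonDyer.Rank1Residual.Additive.QuadraticTwistBSDComparison
import Summits.BirchSwinnertonDyer.Rank1Residual.Additive.X3RankZeroSemistableTwistFactFree
import Summits.BirchSwinnertonDyer.Rank1Residual.Additive.X4RankZeroSemistableTwistOdd
import Summits.BirchSwinnertonDyer.Rank1Residual.AdditivePotMult.Twist
import Literature.NumberTheory.EllipticCurves.LeadingTermPPartProofs
import HarnessLib

/-!
# The twist-transport comparison statement — Layer B: the INSTANCE at an additive prime (cell `b2b-bsdres`, team n1011, route (c), item T-c1)

HONEST FRAMING (cell `b2b-bsdres`, run/shared/lean/b2b/bsd-rank1-residual/, verbatim in every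
file): the goal of the cell is to DELETE the COMBINATION-SHAPED residual classes of the
Birch–Swinnerton-Dyer formula for ALL analytic-rank `≤ 1` elliptic curves over `ℚ` — "full BSD
formula for every rank `≤ 1` curve in class `C`" assembled STRICTLY from published theorems — so
that the rank-`≤ 1` remainder becomes exactly the CONSTRUCTION-SHAPED classes, which are TYPED
(missing-input `Prop`s), NOT attempted. This is not "finishing BSD". Team n1011 (N10 / N11): prove
what is provable now; shrink each hard class to its core with data; no claim beyond stated classes;
research routes; census output = EVIDENCE / conjecture items, never a Literature fact.

Theorems only (no definition, no new named fact). Companion of `QuadraticTwistBSDComparison.lean`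
(Layer A: the comparison statement `TwistComparison.DefectAgreeAt W V p`, its transport
`bsdp_iff_bsdp_of_defectAgreeAt`, and its rank-`0` unfolding into RELATIONS-table columns
`defectAgreeAt_iff_shaIndex_rankZero`). This file instantiates the analytic column at the X4@p /
X3@p twist link of CLASS-CLOSURE-PLAN §3.1 E3 / §3.2 E3 ("X4@3 pair ↔ CLOSED good-ordinary or
multiplicative pair at 3 of the twist"): `W` globally minimal, ADDITIVE at the odd prime `p`,
`W = C • V^{(p*)}` with `V` globally minimal and GOOD or MULTIPLICATIVE at `p`, both of analytic
rank `0`, `f` the newform of `V`.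

HONESTY (REFEREE-1 R4; CLASS-CLOSURE-PLAN §3.1 E3 note, reproduced): `s_W = L(W,1)/Ω(W)` and
`s_V = L(V,1)/Ω(V)` are `±ϖ·∑(a/p)[a/p]^±_f` and `ϖ·[0]⁺_f` — the values of `V`'s modular-symbol
measure at the DIFFERENT characters `χ_{p*}` and `1`. No theorem relates their `p`-adic valuations,
so a CLOSED `(V, p)` (good ordinary: Skinner–Urban / Kato cells; multiplicative: X11a/(ram) cells)
does NOT close `(W, p)`: the `Ш`-column of the GIVEN below is the non-computable input. What the
kernel transports along this twist is the UPPER half only — from Kato's divisibility for `V` over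
`ℚ(μ_{p^∞})` read on the `χ_{p*}`-branch (`X4RankZeroTwistOdd.missingUpperBoundAt`,
`X3RankZeroTwistOdd.*`, `XGord…`/`XMult…CyclotomicPrime*`, lines V9/V9b), or twist-free from Kato
2004 Thm. 14.5 (3) (`X4RankZero.missingUpperBoundAt_of_katoSharp`) — NOT from `BSDp V p`. A
LOWER-half transport would be the main conjecture for `V` on the `ω^{(p−1)/2}`-branch (Delbourgo
1998 'Main Conjecture' p. 151), not in print (Skinner–Urban 2014 Thm. 3.6.4: trivial tame character,
(ram), `p ∤ N`; Wan 2015: `p` unramified); it is N10's typed `MissingLowerBoundAt W p` and is NOT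
claimed. PER-PAIR VACUITY (so that no E3 row is read for more than it says): for two curves of
analytic rank `0` every column of the GIVEN except the `Ш`-column is computable for EACH curve
separately, and `ord_p #Ш_an(W)` is already determined by `W`'s own columns; the twist row therefore
places NO constraint on `Ш(W)` that `W`'s own BSD row does not — its uses are (i) CLASS-level: one
`χ_{p*}`-branch main conjecture for the semistable curves `V` would discharge `MissingLowerBoundAt`
for every additive twist `W` at once (`missingLowerBoundAt_of_bsdp_twist_pos_of_shaIndex_ge` is the
per-pair shadow), and (ii) CONSISTENCY of certified data (`shaIndex_of_bsdp_of_bsdp_of_twist_pos`: a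
row between two BSD-true pairs must balance). This file moves no mark and closes no pair. Binders:
GZK (`hGZK`, bsd.S17), modularity
(`hmod`); Pal 2012 Thm. 3.2 enters PROVED (`pal2012_…_holds` inside
`entireLFunction_one_eq_of_twist_explicit`); no Kim / Kato / Kurihara–Nakamura / Delbourgo fact.

References: Miller 2011 [Miller2011LMS] Def. 1.1; Mazur–Tate–Teitelbaum 1986
[MazurTateTeitelbaum1986Invent] §I.8 (8.6); Pal 2012 [Pal2012] Thm. 3.2, Prop. 2.5; Mazur 1977
[Mazur1977] III.5; Silverman ATAEC IV.9.4; Delbourgo 1998 [Delbourgo1998] p. 151; Skinner–Urban 2014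
[SkinnerUrban2014] Thm. 3.6.4.
-/

noncomputable section

open scoped Classical MatrixGroups ModularForm

open WeierstrassCurve Literature.NumberTheory.EllipticCurves
  Literature.NumberTheory.EllipticCurves.Rank1Residual
  Literature.NumberTheory.EllipticCurves.Rank1Residual.Typed

namespace Summit.BirchSwinnertonDyer.Rank1Residual.Additive

namespace TwistComparison

variable (W V : WeierstrassCurve ℚ) (p : ℕ)

/-! ## Layer B — the INSTANCE at an additive prime: `W = C • V^{(±p)}`, `V` semistable at `p`

The X4@p / X3@p row of the RELATIONS table: `W` (globally minimal) is additive at the odd prime `p`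
and `ℚ`-isomorphic to the quadratic twist by `p* = ±p` of a globally minimal `V` which is good or
multiplicative at `p` (the CLOSED side of the E3 link when `(V, p)` is a closed good-ordinary or
multiplicative cell); both of analytic rank `0`; `f` the newform of `V`. The analytic column
`ord_p s_W − ord_p s_V` is ONE modular-symbol quotient of `f`:
* `p ≡ 1 (mod 4)` (`p* = p`): `s_W = ε·ϖ·(∑_{a mod p} (a/p)[a/p]⁺_f)/|u(C)|`
  (`entireLFunction_one_eq_of_twist_explicit`, Pal 2012 Thm. 3.2 PROVED in the tree),
  `s_V = [0]⁺_f·ϖ` (`IsNewformOf.entireLFunction_one_eq`, MTT §I.8), with the SAME period transfer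
  `ϖ·Ω_V = Ω⁺_f` — so `ϖ` CANCELS and `ord_p |u(C)| = 0` (`padicValRat_u_eq_zero_of_twist_pm_p`):
  the column is `ord_p(∑ (a/p)[a/p]⁺_f) − ord_p [0]⁺_f`, Manin-constant-free and period-free;
* `p ≡ 3 (mod 4)` (`p* = −p`): `s_W = ε·ϖ⁻·(∑ (a/p)[a/p]⁻_f)/(|u(C)|·c_∞(W))`
  (`entireLFunction_one_eq_of_twist_neg`), `s_V = [0]⁺_f·ϖ⁺`; `c_∞ ∈ {1,2}` and `|u(C)|` are
  `p`-units, and the column is `ord_p(∑ (a/p)[a/p]⁻_f) − ord_p [0]⁺_f + (ord_p ϖ⁻ − ord_p ϖ⁺)` — the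
  two period transfers `ϖ⁺·Ω_V = Ω⁺_f`, `ϖ⁻·Ω⁻_V = Ω⁻_f` of `V` do NOT cancel; their quotient is a
  per-pair datum (it is `1` when the period lattice of `f` is the Néron lattice of `V`; no claim).
HONESTY: `∑ (a/p)[a/p]^±_f` and `[0]⁺_f` are the values of `f`'s modular-symbol measure at the
characters `χ_{p*}` and `1` — different characters; nothing relates their valuations (module
docstring). -/

section TwistPair

open CongruenceSubgroup Literature.NumberTheory.EllipticCurves.ModularForms
  Summit.BirchSwinnertonDyer.Rank1Residual.AdditivePotMult

omit V in
/-- `ε = ±1` has valuation `0`. [folklore] -/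
theorem padicValRat_eq_zero_of_eq_one_or_neg_one {ε : ℚ} (hε : ε = 1 ∨ ε = -1) :
    padicValRat p ε = 0 := by
  rcases hε with h | h
  · rw [h, padicValRat.one]
  · rw [h, padicValRat.neg, padicValRat.one]

omit V in
/-- `ord_p |x| = ord_p x`. [folklore] -/
theorem padicValRat_abs (x : ℚ) : padicValRat p |x| = padicValRat p x := by
  rcases abs_choice x with h | h
  · rw [h]
  · rw [h, padicValRat.neg]

variable [Fact p.Prime] [W.IsElliptic] [W.IsGloballyMinimal] [V.IsElliptic] [V.IsGloballyMinimal]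

omit W p [Fact p.Prime] [W.IsElliptic] [W.IsGloballyMinimal] [V.IsGloballyMinimal] in
/-- **The `L`-value presentation of the semistable side**: `L(V,1) = ([0]⁺_f·ϖ)·Ω(V)` for the
newform `f` of `V` and the period transfer `ϖ·Ω_V = Ω⁺_f` (MTT §I.8 `[0]⁺ = L(f,1)/Ω⁺`, tree
theorem `IsNewformOf.entireLFunction_one_eq`). [cite: MazurTateTeitelbaum1986Invent, §I.8 (8.6)] -/
theorem entireLFunction_one_eq_ratPlusSymbol_mul {N : ℕ} [NeZero N] {f : CuspForm (Gamma0 N) 2}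
    (hf : IsNewformOf V f) (ϖ : ℚ) (hϖ : (ϖ : ℝ) * V.realPeriodRat = plusPeriod f) :
    V.entireLFunction 1 = ((ratPlusSymbol f 0 * ϖ : ℚ) : ℂ) * (V.realPeriodRat : ℂ) := by
  rw [hf.entireLFunction_one_eq, ← hϖ]
  push_cast
  ring

/-- **Analytic column at `p ≡ 1 (mod 4)`.** For `W = C • V^{(p)}` (globally minimal models, `V`
good or multiplicative at `p`, `W` additive at `p`, both of analytic rank `0`, `f` the newform of
`V`, `ϖ·Ω_V = Ω⁺_f`): there are `s_W, s_V ∈ ℚ` with `L(W,1) = s_W·Ω(W)`, `L(V,1) = s_V·Ω(V)` and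
`ord_p s_W − ord_p s_V = ord_p(∑_{a mod p} (a/p)[a/p]⁺_f) − ord_p [0]⁺_f` (the transfer `ϖ` cancels;
`ord_p u(C) = 0` by `padicValRat_u_eq_zero_of_twist_pm_p`). Inputs: modularity `hmod`, tree theorems
`entireLFunction_one_eq_of_twist_explicit` (Birch + Pal 2012 Thm. 3.2, proved) and
`IsNewformOf.entireLFunction_one_eq`. [cite: Pal2012, Thm. 3.2] [cite: MazurTateTeitelbaum1986Invent, §I.8 (8.6)] -/
theorem analyticColumn_of_twist_pos (hmod : hasEntireLFunction_rat) (hp4 : p % 4 = 1)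
    (C : VariableChange ℚ) (hC : C • V.quadraticTwist (p : ℚ) = W) (hV : Good V p ∨ Mult V p)
    (hadd : Addv W p) (hrW : W.analyticRank = 0) (hrV : V.analyticRank = 0)
    {N : ℕ} [NeZero N] {f : CuspForm (Gamma0 N) 2} (hf : IsNewformOf V f)
    (ϖ : ℚ) (hϖ : (ϖ : ℝ) * V.realPeriodRat = plusPeriod f) :
    ∃ s s' : ℚ, W.entireLFunction 1 = (s : ℂ) * (W.realPeriodRat : ℂ) ∧
      V.entireLFunction 1 = (s' : ℂ) * (V.realPeriodRat : ℂ) ∧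
      padicValRat p s - padicValRat p s' =
        padicValRat p (legendrePlusSymbolSum f p) - padicValRat p (ratPlusSymbol f 0) := by
  have hp2 : p ≠ 2 := fun h ↦ by subst h; norm_num at hp4
  obtain ⟨ε, hε, hLq⟩ := entireLFunction_one_eq_of_twist_explicit p hmod hp4 V W C hC hadd hf ϖ hϖ
  have hLV := entireLFunction_one_eq_ratPlusSymbol_mul V hf ϖ hϖ
  refine ⟨_, _, hLq, hLV, ?_⟩
  -- non-vanishing of the factors
  have hs0 := ne_zero_of_entireLFunction_one_eq W hmod hrW hLq
  have hs'0 := ne_zero_of_entireLFunction_one_eq V hmod hrV hLV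
  have hε0 : ε ≠ 0 := by rcases hε with h | h <;> rw [h] <;> norm_num
  have hua0 : |(C.u : ℚ)| ≠ 0 := abs_ne_zero.mpr C.u.ne_zero
  have hnum0 : ε * (ϖ * legendrePlusSymbolSum f p) ≠ 0 := by
    intro h; exact hs0 (by rw [h, zero_div])
  have hϖS : ϖ * legendrePlusSymbolSum f p ≠ 0 := fun h ↦ hnum0 (by rw [h, mul_zero])
  have hϖ0 : ϖ ≠ 0 := fun h ↦ hϖS (by rw [h, zero_mul])
  have hS0 : legendrePlusSymbolSum f p ≠ 0 := fun h ↦ hϖS (by rw [h, mul_zero])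
  have hr0 : ratPlusSymbol f 0 ≠ 0 := fun h ↦ hs'0 (by rw [h, zero_mul])
  -- `ord_p u(C) = 0`
  have hC' : C • V.quadraticTwist (((p : ℤ)) : ℚ) = W := by push_cast; exact hC
  have hu : padicValRat p (C.u : ℚ) = 0 :=
    padicValRat_u_eq_zero_of_twist_pm_p p hp2 V W hV (Or.inl rfl) C hC'
  rw [padicValRat.div hnum0 hua0, padicValRat.mul hε0 hϖS, padicValRat.mul hϖ0 hS0,
    padicValRat.mul hr0 hϖ0, padicValRat_abs, hu, padicValRat_eq_zero_of_eq_one_or_neg_one p hε]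
  ring

/-- **Analytic column at `p ≡ 3 (mod 4)`.** For `W = C • V^{(−p)}` (as above; `ϖ⁺·Ω_V = Ω⁺_f`,
`ϖ⁻·Ω⁻_V = Ω⁻_f` the two period transfers of `V`): `s_W, s_V ∈ ℚ` with `L(W,1) = s_W·Ω(W)`,
`L(V,1) = s_V·Ω(V)` and
`ord_p s_W − ord_p s_V = ord_p(∑ (a/p)[a/p]⁻_f) − ord_p [0]⁺_f + (ord_p ϖ⁻ − ord_p ϖ⁺)`
(`c_∞(W) ∈ {1,2}` and `u(C)` are `p`-units). Inputs: `hmod`, `entireLFunction_one_eq_of_twist_neg`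
(odd Birch + Pal for `d < 0`, proved), `IsNewformOf.entireLFunction_one_eq`.
[cite: Pal2012, Thm. 3.2] [cite: MazurTateTeitelbaum1986Invent, §I.8 (8.6)] -/
theorem analyticColumn_of_twist_neg (hmod : hasEntireLFunction_rat) (hp4 : p % 4 = 3)
    (C : VariableChange ℚ) (hC : C • V.quadraticTwist (-(p : ℚ)) = W) (hV : Good V p ∨ Mult V p)
    (hadd : Addv W p) (hrW : W.analyticRank = 0) (hrV : V.analyticRank = 0)
    {N : ℕ} [NeZero N] {f : CuspForm (Gamma0 N) 2} (hf : IsNewformOf V f)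
    (ϖ ϖm : ℚ) (hϖ : (ϖ : ℝ) * V.realPeriodRat = plusPeriod f)
    (hϖm : (ϖm : ℝ) * V.imaginaryPeriodRat = minusPeriod f) :
    ∃ s s' : ℚ, W.entireLFunction 1 = (s : ℂ) * (W.realPeriodRat : ℂ) ∧
      V.entireLFunction 1 = (s' : ℂ) * (V.realPeriodRat : ℂ) ∧
      padicValRat p s - padicValRat p s' =
        padicValRat p (legendreMinusSymbolSum f p) - padicValRat p (ratPlusSymbol f 0) +
          (padicValRat p ϖm - padicValRat p ϖ) := by
  have hp2 : p ≠ 2 := fun h ↦ by subst h; norm_num at hp4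
  obtain ⟨ε, hε, hLq⟩ := entireLFunction_one_eq_of_twist_neg p hmod hp4 V W C hC hadd hf ϖm hϖm
  have hLV := entireLFunction_one_eq_ratPlusSymbol_mul V hf ϖ hϖ
  refine ⟨_, _, hLq, hLV, ?_⟩
  have hs0 := ne_zero_of_entireLFunction_one_eq W hmod hrW hLq
  have hs'0 := ne_zero_of_entireLFunction_one_eq V hmod hrV hLV
  have hε0 : ε ≠ 0 := by rcases hε with h | h <;> rw [h] <;> norm_num
  have hua0 : |(C.u : ℚ)| ≠ 0 := abs_ne_zero.mpr C.u.ne_zero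
  have hcinf0 : (((W.baseChange ℝ).numRealComponents : ℕ) : ℚ) ≠ 0 := by
    rw [numRealComponents]
    split_ifs <;> norm_num
  have hden0 := mul_ne_zero hua0 hcinf0
  have hnum0 : ε * (ϖm * legendreMinusSymbolSum f p) ≠ 0 := by
    intro h; exact hs0 (by rw [h, zero_div])
  have hϖS : ϖm * legendreMinusSymbolSum f p ≠ 0 := fun h ↦ hnum0 (by rw [h, mul_zero])
  have hϖm0 : ϖm ≠ 0 := fun h ↦ hϖS (by rw [h, zero_mul])
  have hS0 : legendreMinusSymbolSum f p ≠ 0 := fun h ↦ hϖS (by rw [h, mul_zero])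
  have hr0 : ratPlusSymbol f 0 ≠ 0 := fun h ↦ hs'0 (by rw [h, zero_mul])
  have hϖ0 : ϖ ≠ 0 := fun h ↦ hs'0 (by rw [h, mul_zero])
  have hC' : C • V.quadraticTwist (((-(p : ℤ)) : ℤ) : ℚ) = W := by push_cast; exact hC
  have hu : padicValRat p (C.u : ℚ) = 0 :=
    padicValRat_u_eq_zero_of_twist_pm_p p hp2 V W hV (Or.inr rfl) C hC'
  rw [padicValRat.div hnum0 hden0, padicValRat.mul hε0 hϖS, padicValRat.mul hϖm0 hS0,
    padicValRat.mul hua0 hcinf0, padicValRat.mul hr0 hϖ0, padicValRat_abs, hu,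
    padicValRat_eq_zero_of_eq_one_or_neg_one p hε, padicValRat_numRealComponents_eq_zero W p hp2]
  ring

/-- **T-c1, the X4@p / X3@p instance at `p ≡ 1 (mod 4)`: `BSDp W p ↔ BSDp V p` GIVEN the `Ш`-index
identity with the modular-symbol column.** `W = C • V^{(p)}` globally minimal and additive at `p`,
`V` globally minimal and good or multiplicative at `p`, both of analytic rank `0`, `f` the newform of
`V` with `ϖ·Ω_V = Ω⁺_f`; GIVEN
`ord_p #Ш(W) − ord_p #Ш(V) = (ord_p ∑(a/p)[a/p]⁺_f − ord_p [0]⁺_f) + 2(ord_p #W(ℚ)_tors − ord_p #V(ℚ)_tors)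
 − (ord_p ∏c(W) − ord_p ∏c(V))`, `BSD(W,p) ⟺ BSD(V,p)`. Binders: GZK `hGZK`, modularity `hmod`;
no Kim / Kato / Kurihara–Nakamura / Delbourgo fact. HONESTY: a CLOSED `(V,p)` does not discharge the
GIVEN — see the module docstring; the kernel's twist route transports the UPPER half only
(`X4RankZeroTwistOdd.missingUpperBoundAt` & co.). [cite: Miller2011LMS, Def. 1.1]
[cite: Pal2012, Thm. 3.2] [cite: MazurTateTeitelbaum1986Invent, §I.8 (8.6)] -/
theorem bsdp_iff_bsdp_of_twist_pos_of_shaIndex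
    (hGZK : rank_eq_analyticRank_of_analyticRank_le_one) (hmod : hasEntireLFunction_rat)
    (hp4 : p % 4 = 1) (C : VariableChange ℚ) (hC : C • V.quadraticTwist (p : ℚ) = W)
    (hV : Good V p ∨ Mult V p) (hadd : Addv W p) (hrW : W.analyticRank = 0)
    (hrV : V.analyticRank = 0) {N : ℕ} [NeZero N] {f : CuspForm (Gamma0 N) 2}
    (hf : IsNewformOf V f) (ϖ : ℚ) (hϖ : (ϖ : ℝ) * V.realPeriodRat = plusPeriod f)
    (hidx : (padicValNat p W.shaOrder : ℤ) - (padicValNat p V.shaOrder : ℤ) =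
        (padicValRat p (legendrePlusSymbolSum f p) - padicValRat p (ratPlusSymbol f 0)) +
          2 * ((padicValNat p W.torsionOrder : ℤ) - (padicValNat p V.torsionOrder : ℤ)) -
          ((padicValNat p W.tamagawaProduct : ℤ) - (padicValNat p V.tamagawaProduct : ℤ))) :
    BSDp W p ↔ BSDp V p := by
  obtain ⟨s, s', hs, hs', hcol⟩ :=
    analyticColumn_of_twist_pos W V p hmod hp4 C hC hV hadd hrW hrV hf ϖ hϖ
  exact bsdp_iff_bsdp_rankZero_of_shaIndex W V p hGZK hmod hrW hrV hs hs' (by rw [hcol]; exact hidx)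

/-- **T-c1, the instance at `p ≡ 3 (mod 4)`** (`W = C • V^{(−p)}`; analytic column with the minus
symbols and the period-transfer quotient `ord_p ϖ⁻ − ord_p ϖ⁺`). Same binders and honesty note.
[cite: Miller2011LMS, Def. 1.1] [cite: Pal2012, Thm. 3.2] [cite: MazurTateTeitelbaum1986Invent, §I.8 (8.6)] -/
theorem bsdp_iff_bsdp_of_twist_neg_of_shaIndex
    (hGZK : rank_eq_analyticRank_of_analyticRank_le_one) (hmod : hasEntireLFunction_rat)
    (hp4 : p % 4 = 3) (C : VariableChange ℚ) (hC : C • V.quadraticTwist (-(p : ℚ)) = W)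
    (hV : Good V p ∨ Mult V p) (hadd : Addv W p) (hrW : W.analyticRank = 0)
    (hrV : V.analyticRank = 0) {N : ℕ} [NeZero N] {f : CuspForm (Gamma0 N) 2}
    (hf : IsNewformOf V f) (ϖ ϖm : ℚ) (hϖ : (ϖ : ℝ) * V.realPeriodRat = plusPeriod f)
    (hϖm : (ϖm : ℝ) * V.imaginaryPeriodRat = minusPeriod f)
    (hidx : (padicValNat p W.shaOrder : ℤ) - (padicValNat p V.shaOrder : ℤ) =
        (padicValRat p (legendreMinusSymbolSum f p) - padicValRat p (ratPlusSymbol f 0) +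
            (padicValRat p ϖm - padicValRat p ϖ)) +
          2 * ((padicValNat p W.torsionOrder : ℤ) - (padicValNat p V.torsionOrder : ℤ)) -
          ((padicValNat p W.tamagawaProduct : ℤ) - (padicValNat p V.tamagawaProduct : ℤ))) :
    BSDp W p ↔ BSDp V p := by
  obtain ⟨s, s', hs, hs', hcol⟩ :=
    analyticColumn_of_twist_neg W V p hmod hp4 C hC hV hadd hrW hrV hf ϖ ϖm hϖ hϖm
  exact bsdp_iff_bsdp_rankZero_of_shaIndex W V p hGZK hmod hrW hrV hs hs' (by rw [hcol]; exact hidx)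

/-- **Necessity of the GIVEN, `p ≡ 1 (mod 4)`**: if `(W,p)` and `(V,p)` are BOTH BSD-true, the
`Ш`-index identity with the modular-symbol column holds — every RELATIONS row linking two closed
pairs balances; a row that fails to balance on certified data refutes `BSD(W,p) ∧ BSD(V,p)`.
[cite: Miller2011LMS, Def. 1.1] -/
theorem shaIndex_of_bsdp_of_bsdp_of_twist_pos
    (hGZK : rank_eq_analyticRank_of_analyticRank_le_one) (hmod : hasEntireLFunction_rat)
    (hp4 : p % 4 = 1) (C : VariableChange ℚ) (hC : C • V.quadraticTwist (p : ℚ) = W)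
    (hV : Good V p ∨ Mult V p) (hadd : Addv W p) (hrW : W.analyticRank = 0)
    (hrV : V.analyticRank = 0) {N : ℕ} [NeZero N] {f : CuspForm (Gamma0 N) 2}
    (hf : IsNewformOf V f) (ϖ : ℚ) (hϖ : (ϖ : ℝ) * V.realPeriodRat = plusPeriod f)
    (hW : BSDp W p) (hVb : BSDp V p) :
    (padicValNat p W.shaOrder : ℤ) - (padicValNat p V.shaOrder : ℤ) =
        (padicValRat p (legendrePlusSymbolSum f p) - padicValRat p (ratPlusSymbol f 0)) +
          2 * ((padicValNat p W.torsionOrder : ℤ) - (padicValNat p V.torsionOrder : ℤ)) -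
          ((padicValNat p W.tamagawaProduct : ℤ) - (padicValNat p V.tamagawaProduct : ℤ)) := by
  obtain ⟨s, s', hs, hs', hcol⟩ :=
    analyticColumn_of_twist_pos W V p hmod hp4 C hC hV hadd hrW hrV hf ϖ hϖ
  rw [← hcol]
  exact shaIndex_of_bsdp_of_bsdp_rankZero W V p hGZK hmod hrW hrV hs hs' hW hVb

/-- **LOWER half of the additive pair from the CLOSED semistable twist and the `Ш`-index
INEQUALITY, `p ≡ 1 (mod 4)`**: `BSDp V p` and
`ord_p #Ш(W) − ord_p #Ш(V) ≥ (ord_p ∑(a/p)[a/p]⁺_f − ord_p [0]⁺_f) + 2Δ_tors − Δ_Tam` give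
`MissingLowerBoundAt W p` — N10's typed object at this pair. (Per pair the inequality needs enough
certified elements of `Ш(W)[p^∞]`; class-wide it is the `χ_p`-branch main conjecture for `V`, not
in print.) [cite: Miller2011LMS, Def. 1.1] -/
theorem missingLowerBoundAt_of_bsdp_twist_pos_of_shaIndex_ge
    (hGZK : rank_eq_analyticRank_of_analyticRank_le_one) (hmod : hasEntireLFunction_rat)
    (hp4 : p % 4 = 1) (C : VariableChange ℚ) (hC : C • V.quadraticTwist (p : ℚ) = W)
    (hV : Good V p ∨ Mult V p) (hadd : Addv W p) (hrW : W.analyticRank = 0)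
    (hrV : V.analyticRank = 0) {N : ℕ} [NeZero N] {f : CuspForm (Gamma0 N) 2}
    (hf : IsNewformOf V f) (ϖ : ℚ) (hϖ : (ϖ : ℝ) * V.realPeriodRat = plusPeriod f)
    (hVb : BSDp V p)
    (hge : (padicValRat p (legendrePlusSymbolSum f p) - padicValRat p (ratPlusSymbol f 0)) +
          2 * ((padicValNat p W.torsionOrder : ℤ) - (padicValNat p V.torsionOrder : ℤ)) -
          ((padicValNat p W.tamagawaProduct : ℤ) - (padicValNat p V.tamagawaProduct : ℤ)) ≤
        (padicValNat p W.shaOrder : ℤ) - (padicValNat p V.shaOrder : ℤ)) :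
    MissingLowerBoundAt W p := by
  obtain ⟨s, s', hs, hs', hcol⟩ :=
    analyticColumn_of_twist_pos W V p hmod hp4 C hC hV hadd hrW hrV hf ϖ hϖ
  exact missingLowerBoundAt_of_bsdp_of_shaIndex_ge W V p hGZK hmod hrW hrV hs hs' hVb
    (by rw [hcol]; exact hge)

/-- **UPPER half of the additive pair from the CLOSED semistable twist and the reverse `Ш`-index
inequality, `p ≡ 1 (mod 4)`.** (Unconditionally-in-the-GIVEN versions of the upper half at such
pairs are the V9/V9b/Kato chains; this reading only records the bookkeeping direction.)
[cite: Miller2011LMS, Def. 1.1] -/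
theorem missingUpperBoundAt_of_bsdp_twist_pos_of_shaIndex_le
    (hGZK : rank_eq_analyticRank_of_analyticRank_le_one) (hmod : hasEntireLFunction_rat)
    (hp4 : p % 4 = 1) (C : VariableChange ℚ) (hC : C • V.quadraticTwist (p : ℚ) = W)
    (hV : Good V p ∨ Mult V p) (hadd : Addv W p) (hrW : W.analyticRank = 0)
    (hrV : V.analyticRank = 0) {N : ℕ} [NeZero N] {f : CuspForm (Gamma0 N) 2}
    (hf : IsNewformOf V f) (ϖ : ℚ) (hϖ : (ϖ : ℝ) * V.realPeriodRat = plusPeriod f)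
    (hVb : BSDp V p)
    (hle : (padicValNat p W.shaOrder : ℤ) - (padicValNat p V.shaOrder : ℤ) ≤
        (padicValRat p (legendrePlusSymbolSum f p) - padicValRat p (ratPlusSymbol f 0)) +
          2 * ((padicValNat p W.torsionOrder : ℤ) - (padicValNat p V.torsionOrder : ℤ)) -
          ((padicValNat p W.tamagawaProduct : ℤ) - (padicValNat p V.tamagawaProduct : ℤ))) :
    MissingUpperBoundAt W p := by
  obtain ⟨s, s', hs, hs', hcol⟩ :=
    analyticColumn_of_twist_pos W V p hmod hp4 C hC hV hadd hrW hrV hf ϖ hϖ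
  exact missingUpperBoundAt_of_bsdp_of_shaIndex_le W V p hGZK hmod hrW hrV hs hs' hVb
    (by rw [hcol]; exact hle)

/-- **Class X4 reading (`p ≡ 1 (mod 4)`): the torsion column VANISHES.** On X4 (`W[p]`
irreducible) the twist `V` also has irreducible `p`-torsion (`irr_iff_of_model_twist`), so
`ord_p #W(ℚ)_tors = ord_p #V(ℚ)_tors = 0` (Mazur: a rational point of order `p` spans a stable line;
`padicValNat_torsionOrder_eq_zero_of_irreducible`) and the GIVEN reads
`ord_p #Ш(W) − ord_p #Ш(V) = (ord_p ∑(a/p)[a/p]⁺_f − ord_p [0]⁺_f) − (ord_p ∏c(W) − ord_p ∏c(V))`.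
[cite: Miller2011LMS, Def. 1.1] [cite: Mazur1977, Ch. III §5, p. 157] -/
theorem ClassX4.bsdp_iff_bsdp_of_twist_pos_of_shaIndex
    (hGZK : rank_eq_analyticRank_of_analyticRank_le_one) (hmod : hasEntireLFunction_rat)
    (hp4 : p % 4 = 1) (hX : ClassX4 W p) (C : VariableChange ℚ)
    (hC : C • V.quadraticTwist (p : ℚ) = W) (hV : Good V p ∨ Mult V p)
    (hrW : W.analyticRank = 0) (hrV : V.analyticRank = 0) {N : ℕ} [NeZero N]
    {f : CuspForm (Gamma0 N) 2} (hf : IsNewformOf V f) (ϖ : ℚ)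
    (hϖ : (ϖ : ℝ) * V.realPeriodRat = plusPeriod f)
    (hidx : (padicValNat p W.shaOrder : ℤ) - (padicValNat p V.shaOrder : ℤ) =
        (padicValRat p (legendrePlusSymbolSum f p) - padicValRat p (ratPlusSymbol f 0)) -
          ((padicValNat p W.tamagawaProduct : ℤ) - (padicValNat p V.tamagawaProduct : ℤ))) :
    BSDp W p ↔ BSDp V p := by
  have hp0 : (p : ℚ) ≠ 0 := by exact_mod_cast (Fact.out : p.Prime).ne_zero
  have hirrW : Irr W p := hX.2.2
  have hirrV : Irr V p := (irr_iff_of_model_twist (W := V) (p := p) hp0 ⟨C, hC⟩).mp hirrW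
  have htW := padicValNat_torsionOrder_eq_zero_of_irreducible W p hirrW
  have htV := padicValNat_torsionOrder_eq_zero_of_irreducible V p hirrV
  refine TwistComparison.bsdp_iff_bsdp_of_twist_pos_of_shaIndex W V p hGZK hmod hp4 C hC hV hX.2.1
    hrW hrV hf ϖ hϖ ?_
  rw [hidx, htW, htV]
  push_cast
  ring

/-- **Class X4 reading (`p ≡ 3 (mod 4)`)**: torsion column vanishes; analytic column with the minus
symbols and the period-transfer quotient. [cite: Miller2011LMS, Def. 1.1] [cite: Mazur1977, Ch. III §5, p. 157] -/
theorem ClassX4.bsdp_iff_bsdp_of_twist_neg_of_shaIndex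
    (hGZK : rank_eq_analyticRank_of_analyticRank_le_one) (hmod : hasEntireLFunction_rat)
    (hp4 : p % 4 = 3) (hX : ClassX4 W p) (C : VariableChange ℚ)
    (hC : C • V.quadraticTwist (-(p : ℚ)) = W) (hV : Good V p ∨ Mult V p)
    (hrW : W.analyticRank = 0) (hrV : V.analyticRank = 0) {N : ℕ} [NeZero N]
    {f : CuspForm (Gamma0 N) 2} (hf : IsNewformOf V f) (ϖ ϖm : ℚ)
    (hϖ : (ϖ : ℝ) * V.realPeriodRat = plusPeriod f)
    (hϖm : (ϖm : ℝ) * V.imaginaryPeriodRat = minusPeriod f)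
    (hidx : (padicValNat p W.shaOrder : ℤ) - (padicValNat p V.shaOrder : ℤ) =
        (padicValRat p (legendreMinusSymbolSum f p) - padicValRat p (ratPlusSymbol f 0) +
            (padicValRat p ϖm - padicValRat p ϖ)) -
          ((padicValNat p W.tamagawaProduct : ℤ) - (padicValNat p V.tamagawaProduct : ℤ))) :
    BSDp W p ↔ BSDp V p := by
  have hp0 : (-(p : ℚ)) ≠ 0 := by
    rw [neg_ne_zero]; exact_mod_cast (Fact.out : p.Prime).ne_zero
  have hirrW : Irr W p := hX.2.2
  have hirrV : Irr V p := (irr_iff_of_model_twist (W := V) (p := p) hp0 ⟨C, hC⟩).mp hirrW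
  have htW := padicValNat_torsionOrder_eq_zero_of_irreducible W p hirrW
  have htV := padicValNat_torsionOrder_eq_zero_of_irreducible V p hirrV
  refine TwistComparison.bsdp_iff_bsdp_of_twist_neg_of_shaIndex W V p hGZK hmod hp4 C hC hV
    hX.2.1 hrW hrV hf ϖ ϖm hϖ hϖm ?_
  rw [hidx, htW, htV]
  push_cast
  ring

end TwistPair

end TwistComparison

end Summit.BirchSwinnertonDyer.Rank1Residual.Additive

end
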